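import Literature.Geometry.Riemannian.PerelmanEntropyFormulaManifold
import HarnessLib

/-!
# Perelman's entropy formula: Topping's Prop. 8.2.6 as an IDENTITY on a manifold, and
# `d𝒲/dt = ∫ 2τ |Ric + Hess f − g/2τ|² u dV` (Perelman 2002, (3.4); Topping 2006, Prop. 8.2.1)

`PerelmanEntropyFormulaManifold.lean` transports the SIGN of Topping's Prop. 8.2.6 from the chart
(`CoordConjugateHeat.lean`) to the manifold. This file transports the full identity

  `□* v = −2τ |Ric + Hess f − g/(2τ)|²_g u`,   `v = [τ(2Δf − |∇f|² + R) + f − n] u`,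

for a positive solution `u` of the conjugate heat equation along a Ricci flow (any manifold with
boundaryless finite-dimensional model; `IsRicciFlow.conjugateHeatOp_entropyIntegrand_eq`), after
completing the chart dictionary by the Hessian, the Ricci tensor and the metric square norm
(`hessAt_chartRep_eq_apply`, `ricAt_chartRep_eq_apply`, `normSqAt_chartRep_eq`; O'Neill 1983,
Ch. 3, Prop. 3.59). Integrating over a closed manifold modelled on `ℝ^m` with Topping's (6.3.2)
(`IsRicciFlow.integral_sub_eq_neg_integral_conjugateHeatOp`) and Rem. 8.2.7
(`wEntropy_eq_integral_conjugateHeatIntegrand`, `𝒲 = ∫ v dV`) gives **Perelman's entropy formula**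
(2002, (3.4); Topping 2006, Prop. 8.2.1 under the coupled system (8.2.1)):

  `d/dt 𝒲(g(t), f(t), τ₀ − t) = ∫_M 2τ |Ric + Hess f − g/(2τ)|² u dV_{g(t)}`

(`IsRicciFlow.hasDerivWithinAt_wEntropy`, derivative within `[0, T']`, one-sided at the end
points). Everything is proved; no definition, no named fact. The Hessian `Hess_{g(t)}` is the
tree's `PseudoRiemannianMetric.hessian` under its standing instance `[(g t).HasLeviCivita]`
(a `Prop`; supplied by `(g t).hasLeviCivita`).

## References

* G. Perelman, *The entropy formula for the Ricci flow and its geometric applications*,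
  arXiv:math/0211159 (2002), §3.1, (3.3)–(3.4); §9, Prop. 9.1. [Perelman2002]
* P. Topping, *Lectures on the Ricci flow*, LMS Lecture Note Series 325, CUP 2006, §6.3, (6.3.2);
  §8.2, (8.2.1)–(8.2.3), Prop. 8.2.1, Prop. 8.2.6, Rem. 8.2.7. [Topping2006]
* B. O'Neill, *Semi-Riemannian geometry with applications to relativity*, Academic Press 1983,
  Ch. 3, Prop. 3.59 and pp. 60–61, 90–91. [ONeill1983]
-/

noncomputable section

open Set Function Filter Manifold Bundle MeasureTheory Module
open scoped Manifold ContDiff Topology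

namespace Literature.Geometry.Riemannian

open Lorentzian Lorentzian.PseudoRiemannianMetric

universe u v w

/-! ### The chart dictionary for `Hess F`, `Ric` and `|Ric + Hess F − c g|²` -/

section ChartBridge

variable {E : Type*} [NormedAddCommGroup E] [NormedSpace ℝ E] [FiniteDimensional ℝ E]
  [CompleteSpace E] {H : Type*} [TopologicalSpace H] {I : ModelWithCorners ℝ E H} [I.Boundaryless]
  {M : Type*} [TopologicalSpace M] [ChartedSpace H M] [IsManifold I ∞ M]

/-- **`Hess F` read in the chart of a family**: for the chart components `chartRep I g x₀ s` of
`g s`, a representative `Fc` of `F` on the chart target, `C²` at `y`, with `F` of class `C²` at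
`Φ y`: `hessAt (G s) Fc y (v, w) = Hess_{g s} F (Φ y)(dΦ v, dΦ w)` (`hessian_comap_apply`,
`OpensChart.hessian_eq_hessAt`). [cite: ONeill1983, Ch. 3, Prop. 3.59] -/
theorem hessAt_chartRep_eq_apply (g : ℝ → PseudoRiemannianMetric I ∞ E (TangentSpace I : M → Type _))
    (x₀ : M) (s : ℝ) [(g s).HasLeviCivita] (y : chartTarget I x₀) {F : M → ℝ} {Fc : E → ℝ}
    (hrep : ∀ y : chartTarget I x₀, F (chartInv I x₀ y) = Fc y)
    (hF : ContMDiffAt I 𝓘(ℝ, ℝ) 2 F (chartInv I x₀ y)) (hFc : ContDiffAt ℝ 2 Fc y) (v w : E) :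
    MetricCoord.hessAt (chartRep I g x₀ s) Fc y v w =
      (g s).hessian F (chartInv I x₀ y) (mfderiv 𝓘(ℝ, E) I (chartInv I x₀) y v)
        (mfderiv 𝓘(ℝ, E) I (chartInv I x₀) y w) := by
  haveI := (chartPullback I (g s) x₀).hasLeviCivita
  have hG := val_chartPullback_eq_chartRep g x₀ s
  rw [← Lorentzian.OpensChart.hessian_eq_hessAt hG y (f := F ∘ chartInv I x₀) hrep hFc v w,
    (g s).hessian_comap_apply contMDiff_pullbackBilin_holds (contMDiff_chartInv x₀)
      (injective_mfderiv_chartInv x₀) rfl hF v w]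

/-- **`Ric` read in the chart of a family**: `ricAt (G s) y (v, w) = Ric_{g s}(Φ y)(dΦ v, dΦ w)`
(`ricci_comap_apply`, `OpensChart.ricci_eq_ricAt`). [cite: ONeill1983, Ch. 3, Prop. 3.59] -/
theorem ricAt_chartRep_eq_apply (g : ℝ → PseudoRiemannianMetric I ∞ E (TangentSpace I : M → Type _))
    (x₀ : M) (s : ℝ) [(g s).HasLeviCivita] (y : chartTarget I x₀) (v w : E) :
    MetricCoord.ricAt (chartRep I g x₀ s) y v w =
      (g s).ricci (chartInv I x₀ y) (mfderiv 𝓘(ℝ, E) I (chartInv I x₀) y v)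
        (mfderiv 𝓘(ℝ, E) I (chartInv I x₀) y w) := by
  haveI := (chartPullback I (g s) x₀).hasLeviCivita
  have hG := val_chartPullback_eq_chartRep g x₀ s
  rw [← Lorentzian.OpensChart.ricci_eq_ricAt hG y v w,
    (g s).ricci_comap_apply contMDiff_pullbackBilin_holds (contMDiff_chartInv x₀)
      (injective_mfderiv_chartInv x₀) rfl y v w]

/-- **`|Ric + Hess F − c g|²` read in the chart of a family**: the coordinate square norm
`normSqAt (G s) y (ricAt + hessAt Fc − c G)` is the metric square norm
`|Ric_{g s} + Hess_{g s} F − c (g s)|²_{g s} (Φ y)` (`normSq_chartPullback_eq`,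
`OpensChart.normSq_eq_normSqAt`, and the dictionary for `Ric`, `Hess`, `g`).
[cite: ONeill1983, Ch. 3, Prop. 3.59 and pp. 60–61] -/
theorem normSqAt_chartRep_eq (g : ℝ → PseudoRiemannianMetric I ∞ E (TangentSpace I : M → Type _))
    (x₀ : M) (s : ℝ) [(g s).HasLeviCivita] (y : chartTarget I x₀) {F : M → ℝ} {Fc : E → ℝ}
    (hrep : ∀ y : chartTarget I x₀, F (chartInv I x₀ y) = Fc y)
    (hF : ContMDiffAt I 𝓘(ℝ, ℝ) 2 F (chartInv I x₀ y)) (hFc : ContDiffAt ℝ 2 Fc y) (c : ℝ) :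
    MetricCoord.normSqAt (chartRep I g x₀ s) y
        (MetricCoord.ricAt (chartRep I g x₀ s) y + MetricCoord.hessAt (chartRep I g x₀ s) Fc y -
          c • chartRep I g x₀ s y) =
      (g s).normSq (chartInv I x₀ y) ((g s).ricci (chartInv I x₀ y) +
        (g s).hessian F (chartInv I x₀ y) - c • (g s).toBilinForm (chartInv I x₀ y)) := by
  haveI := (chartPullback I (g s) x₀).hasLeviCivita
  have hG := val_chartPullback_eq_chartRep g x₀ s
  -- the bilinear form read on the chart target, as a form on `T_y (chartTarget)`
  set B₁ : LinearMap.BilinForm ℝ (TangentSpace 𝓘(ℝ, E) y) :=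
    (chartPullback I (g s) x₀).ricci y + (chartPullback I (g s) x₀).hessian (F ∘ chartInv I x₀) y -
      c • (chartPullback I (g s) x₀).toBilinForm y with hB₁
  have hB₁vw : ∀ v w : E, B₁ v w = (chartPullback I (g s) x₀).ricci y v w +
      (chartPullback I (g s) x₀).hessian (F ∘ chartInv I x₀) y v w -
      c * (chartPullback I (g s) x₀).val y v w := fun v w ↦ rfl
  -- (a) identity chart: `|B₁|² = normSqAt G β`
  have hO := Lorentzian.OpensChart.normSq_eq_normSqAt hG y B₁
    (MetricCoord.ricAt (chartRep I g x₀ s) y + MetricCoord.hessAt (chartRep I g x₀ s) Fc y -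
      c • chartRep I g x₀ s y)
    (fun v w ↦ by
      have e : (chartPullback I (g s) x₀).ricci y v w +
          (chartPullback I (g s) x₀).hessian (F ∘ chartInv I x₀) y v w -
          c * (chartPullback I (g s) x₀).val y v w =
          MetricCoord.ricAt (chartRep I g x₀ s) y v w +
            MetricCoord.hessAt (chartRep I g x₀ s) Fc y v w - c * chartRep I g x₀ s y v w := by
        rw [Lorentzian.OpensChart.ricci_eq_ricAt hG y v w,
          Lorentzian.OpensChart.hessian_eq_hessAt hG y (f := F ∘ chartInv I x₀) hrep hFc v w, hG y]
        rfl
      exact (hB₁vw v w).trans e)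
  -- (b) pullback: `|B₁|²_{Φ^*g}(y) = |B|²_g (Φ y)`
  refine hO.symm.trans (normSq_chartPullback_eq (g s) x₀ y B₁ _ fun v w ↦ ?_)
  have e : (chartPullback I (g s) x₀).ricci y v w +
      (chartPullback I (g s) x₀).hessian (F ∘ chartInv I x₀) y v w -
      c * (chartPullback I (g s) x₀).val y v w =
      (g s).ricci (chartInv I x₀ y) (mfderiv 𝓘(ℝ, E) I (chartInv I x₀) y v)
          (mfderiv 𝓘(ℝ, E) I (chartInv I x₀) y w) +
        (g s).hessian F (chartInv I x₀ y) (mfderiv 𝓘(ℝ, E) I (chartInv I x₀) y v)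
          (mfderiv 𝓘(ℝ, E) I (chartInv I x₀) y w) -
        c * (g s).val (chartInv I x₀ y) (mfderiv 𝓘(ℝ, E) I (chartInv I x₀) y v)
          (mfderiv 𝓘(ℝ, E) I (chartInv I x₀) y w) := by
    rw [(g s).ricci_comap_apply contMDiff_pullbackBilin_holds (contMDiff_chartInv x₀)
        (injective_mfderiv_chartInv x₀) rfl y v w,
      (g s).hessian_comap_apply contMDiff_pullbackBilin_holds (contMDiff_chartInv x₀)
        (injective_mfderiv_chartInv x₀) rfl hF v w, val_chartPullback_apply]
  exact (hB₁vw v w).trans e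

end ChartBridge

/-! ### Topping's Prop. 8.2.6 as an identity on a manifold -/

section Pointwise

variable {E : Type*} [NormedAddCommGroup E] [NormedSpace ℝ E] [FiniteDimensional ℝ E]
  [CompleteSpace E] {H : Type*} [TopologicalSpace H] {I : ModelWithCorners ℝ E H} [I.Boundaryless]
  {M : Type*} [TopologicalSpace M] [ChartedSpace H M] [IsManifold I ∞ M]
  {g : ℝ → PseudoRiemannianMetric I ∞ E (TangentSpace I : M → Type _)}
  {cov : ℝ → CovariantDerivative I E (TangentSpace I : M → Type _)}

/-- **Topping 2006, Prop. 8.2.6 on a manifold (Perelman's pointwise entropy formula, 2002,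
Prop. 9.1).** Let `(g, cov)` be a Ricci flow on `[0, T']`, `T' > 0`, on a manifold with
boundaryless model `E` of dimension `n`, let `u > 0` be a smooth solution of the conjugate heat
equation `□* u = 0` on `M × [0, T']` (`IsConjugateHeatSolutionOn`), and `τ₀ > T'`, `τ = τ₀ − t`.
Then Topping's `v = [τ(2Δf − |∇f|² + R) + f − n] u`, `f = −log u − (n/2) log(4πτ)`
(`entropyIntegrand`), satisfies at every `(x, t) ∈ M × [0, T']`

  `□* v = −2τ |Ric + Hess f − g/(2τ)|²_{g(t)} u`

(`normSq` of the bilinear form `Ric_{g(t)} + Hess_{g(t)} f(t) − (2τ)⁻¹ g(t)` on `T_x M`). Proof: the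
coordinate identity `MetricCoord.IsMetricFamilyOn.conjHeat_entropyDensity_identity`
(`CoordConjugateHeat.lean`) read back through the chart at `x` (`lapAt_chartRep_eq`,
`gradSqAt_chartRep_eq`, `scalAt_chartRep_eq`, `normSqAt_chartRep_eq`). No compactness and no
signature assumption is needed. [cite: Topping2006, §8.2, Prop. 8.2.6] [cite: Perelman2002, §9, Prop. 9.1] -/
theorem IsRicciFlow.conjugateHeatOp_entropyIntegrand_eq {T' : ℝ} (hT' : 0 < T')
    (h : IsRicciFlow g cov (Icc 0 T')) {u : ℝ → M → ℝ} (hpos : ∀ t ∈ Icc 0 T', ∀ x, 0 < u t x)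
    (hsol : IsConjugateHeatSolutionOn g cov (Icc 0 T') u) {n : ℕ} (hn : Module.finrank ℝ E = n)
    {τ₀ : ℝ} (hτ₀ : T' < τ₀) {t : ℝ} (ht : t ∈ Icc 0 T') [(g t).HasLeviCivita] (x : M) :
    conjugateHeatOp g cov (Icc 0 T') (entropyIntegrand g cov u n τ₀) t x =
      -(2 * (τ₀ - t)) * (g t).normSq x ((g t).ricci x +
        (g t).hessian (entropyPotential u n τ₀ t) x - (2 * (τ₀ - t))⁻¹ • (g t).toBilinForm x) *
        u t x := by
  have h2 : (2 : ℕ∞ω) ≤ ∞ := WithTop.coe_le_coe.mpr le_top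
  have hu := hsol.1
  have hpde := hsol.2
  have hVopen : IsOpen (extChartAt I x).target := isOpen_extChartAt_target x
  -- (1) the flow read in the chart at `x` is a coordinate Ricci flow
  have hfam := h.isMetricFamilyOn_chartRep hT' x
  have hfl : ∀ s ∈ Icc 0 T', ∀ y ∈ (extChartAt I x).target,
      MetricCoord.tDeriv (chartRep I g x) (Icc 0 T') s y =
        (-2 : ℝ) • MetricCoord.ricAt (chartRep I g x s) y := fun s hs y hy ↦
    h.tDeriv_chartRep_eq hT' x hs hy
  -- (2) the solution read in the chart
  set uc : ℝ → E → ℝ := fun s y ↦ u s ((extChartAt I x).symm y) with huc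
  have huc_smooth : ContDiffOn ℝ ∞ (fun q : E × ℝ ↦ uc q.2 q.1)
      ((extChartAt I x).target ×ˢ Icc 0 T') :=
    contDiffOn_chart_of_contMDiffOn_source_prod (k := (⊤ : ℕ∞)) (w := u) x
      (hu.mono (prod_mono (subset_univ _) Subset.rfl))
  have huc_pos : ∀ s ∈ Icc 0 T', ∀ y ∈ (extChartAt I x).target, 0 < uc s y :=
    fun s hs y _ ↦ hpos s hs _
  have hc : ∀ s ∈ Icc 0 T', s < τ₀ := fun s hs ↦ hs.2.trans_lt hτ₀
  have hslice : ∀ s ∈ Icc 0 T', ContMDiff I 𝓘(ℝ, ℝ) ∞ (u s) := fun s hs ↦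
    contMDiff_slice_of_contMDiffOn hu hs
  have huc2 : ∀ s ∈ Icc 0 T', ∀ y : chartTarget I x, ContDiffAt ℝ 2 (uc s) y := fun s hs y ↦
    (((MetricCoord.contDiffOn_of_family huc_smooth hs).contDiffAt (hVopen.mem_nhds y.2)).of_le h2)
  have hurep : ∀ s, ∀ y : chartTarget I x, u s (chartInv I x y) = uc s y := fun s y ↦ rfl
  -- (3) the conjugate heat equation read in the chart
  have hueq : ∀ s ∈ Icc 0 T', ∀ y ∈ (extChartAt I x).target,
      MetricCoord.tDerivFun uc (Icc 0 T') s y =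
        -MetricCoord.lapAt (chartRep I g x s) (uc s) y +
          MetricCoord.scalAt (chartRep I g x s) y * uc s y := by
    intro s hs y hy
    have hΔ := lapAt_chartRep_eq g x s ⟨y, hy⟩ (hurep s) (((hslice s hs) _).of_le h2)
      (huc2 s hs ⟨y, hy⟩)
    have hRs := h.scalAt_chartRep_eq x hs ⟨y, hy⟩
    rw [MetricCoord.tDerivFun, hΔ, hRs]
    exact hpde s hs _
  -- (4) the base point in the chart
  have hy₀ : extChartAt I x x ∈ (extChartAt I x).target := mem_extChartAt_target x
  -- (5) Prop. 8.2.6 for the components (the identity)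
  have key := hfam.conjHeat_entropyDensity_identity hfl huc_smooth huc_pos hc hy₀ ht (hueq t ht)
  -- (6) the potential and Topping's `v` read in the chart
  have hlog : ContDiffOn ℝ ∞ (fun s : ℝ ↦ (n : ℝ) / 2 * Real.log (4 * Real.pi * (τ₀ - s)))
      (Icc 0 T') := by
    intro s hs
    have hpos' : 4 * Real.pi * (τ₀ - s) ≠ 0 := by
      have : 0 < τ₀ - s := by linarith [hs.2]
      positivity
    exact (contDiffAt_const.mul ((Real.contDiffAt_log.2 hpos').comp s
      (contDiffAt_const.mul (contDiffAt_const.sub contDiffAt_id)))).contDiffWithinAt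
  have hf : ContMDiffOn (I.prod 𝓘(ℝ, ℝ)) 𝓘(ℝ, ℝ) ∞
      (fun p : M × ℝ ↦ entropyPotential u n τ₀ p.2 p.1) (univ ×ˢ Icc 0 T') :=
    (contMDiffOn_neg_log_prod hpos hu).sub (contMDiffOn_of_time hlog)
  have hfc : ContDiffOn ℝ ∞ (fun q : E × ℝ ↦ MetricCoord.conjHeatPotential uc τ₀ q.2 q.1)
      ((extChartAt I x).target ×ˢ Icc 0 T') :=
    MetricCoord.IsMetricFamilyOn.contDiffOn_conjHeatPotential huc_smooth huc_pos hc
  have hfrep : ∀ s, ∀ y : chartTarget I x,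
      entropyPotential u n τ₀ s (chartInv I x y) = MetricCoord.conjHeatPotential uc τ₀ s y := by
    intro s y
    rw [entropyPotential_apply, MetricCoord.conjHeatPotential_apply, hn]
    rfl
  have hf2 : ∀ s ∈ Icc 0 T', ∀ y : chartTarget I x,
      ContMDiffAt I 𝓘(ℝ, ℝ) 2 (entropyPotential u n τ₀ s) (chartInv I x y) := fun s hs y ↦
    ((contMDiff_slice_of_contMDiffOn hf hs) _).of_le h2
  have hfc2 : ∀ s ∈ Icc 0 T', ∀ y : chartTarget I x,
      ContDiffAt ℝ 2 (MetricCoord.conjHeatPotential uc τ₀ s) y := fun s hs y ↦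
    (((MetricCoord.contDiffOn_of_family hfc hs).contDiffAt (hVopen.mem_nhds y.2)).of_le h2)
  have hwrep : ∀ s ∈ Icc 0 T', ∀ y : chartTarget I x,
      entropyIntegrand g cov u n τ₀ s (chartInv I x y) =
        MetricCoord.conjHeatEntropyDensity (chartRep I g x) uc τ₀ s y := by
    intro s hs y
    have hΔ := lapAt_chartRep_eq g x s y (hfrep s) (hf2 s hs y) (hfc2 s hs y)
    have hgr := gradSqAt_chartRep_eq g x s y (hfrep s)
      ((hf2 s hs y).mdifferentiableAt two_ne_zero) ((hfc2 s hs y).differentiableAt two_ne_zero)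
    have hRs := h.scalAt_chartRep_eq x hs y
    rw [entropyIntegrand_apply, MetricCoord.conjHeatEntropyDensity_apply,
      MetricCoord.entropyIntegrand_apply, hΔ, hgr, hRs, ← hfrep s y, hn, hurep s y]
  -- (7) the three terms of `□* v` at `(x, t)` read in the chart
  have hΦ0 : chartInv I x ⟨extChartAt I x x, hy₀⟩ = x := extChartAt_to_inv x
  have hW : ContMDiffOn (I.prod 𝓘(ℝ, ℝ)) 𝓘(ℝ, ℝ) ∞
      (fun p : M × ℝ ↦ entropyIntegrand g cov u n τ₀ p.2 p.1) (univ ×ˢ Icc 0 T') :=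
    h.contMDiffOn_conjugateHeatIntegrand hT' hτ₀ hpos hu n
  have hWc : ContDiffOn ℝ ∞ (MetricCoord.conjHeatEntropyDensity (chartRep I g x) uc τ₀ t)
      (extChartAt I x).target := by
    have hGt := hfam.isMetricOn t ht
    have hft := MetricCoord.contDiffOn_of_family hfc ht
    have hut := MetricCoord.contDiffOn_of_family huc_smooth ht
    have hPt : ContDiffOn ℝ ∞ (MetricCoord.entropyIntegrand (chartRep I g x)
        (MetricCoord.conjHeatPotential uc τ₀) (fun s ↦ τ₀ - s) t) (extChartAt I x).target :=
      ((contDiffOn_const.mul (((contDiffOn_const.mul (hGt.contDiffOn_lapAt hft)).sub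
        (hGt.contDiffOn_gradSqAt hft)).add hGt.contDiffOn_scalAt)).add hft).sub contDiffOn_const
    exact hPt.mul hut
  have e0 : ∀ s ∈ Icc 0 T', entropyIntegrand g cov u n τ₀ s x =
      MetricCoord.conjHeatEntropyDensity (chartRep I g x) uc τ₀ s (extChartAt I x x) := by
    intro s hs
    have h' := hwrep s hs ⟨extChartAt I x x, hy₀⟩
    rwa [hΦ0] at h'
  have e1 : derivWithin (fun s ↦ entropyIntegrand g cov u n τ₀ s x) (Icc 0 T') t =
      MetricCoord.tDerivFun (MetricCoord.conjHeatEntropyDensity (chartRep I g x) uc τ₀)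
        (Icc 0 T') t (extChartAt I x x) := by
    rw [MetricCoord.tDerivFun]
    exact derivWithin_congr (fun s hs ↦ e0 s hs) (e0 t ht)
  have e2 : (g t).laplaceBeltrami (entropyIntegrand g cov u n τ₀ t) x =
      MetricCoord.lapAt (chartRep I g x t)
        (MetricCoord.conjHeatEntropyDensity (chartRep I g x) uc τ₀ t) (extChartAt I x x) := by
    have h' := lapAt_chartRep_eq g x t ⟨extChartAt I x x, hy₀⟩ (hwrep t ht)
      (by rw [hΦ0]; exact ((contMDiff_slice_of_contMDiffOn hW ht) x).of_le h2)
      (MetricCoord.contDiffAt_two_of_contDiffOn hVopen hWc hy₀)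
    rw [hΦ0] at h'
    exact h'.symm
  have e3 : (g t).scalarCurvatureWith (cov t) x =
      MetricCoord.scalAt (chartRep I g x t) (extChartAt I x x) := by
    have h' := h.scalAt_chartRep_eq x ht ⟨extChartAt I x x, hy₀⟩
    rw [hΦ0] at h'
    exact h'.symm
  -- (8) the square norm read in the chart
  have e4 := normSqAt_chartRep_eq g x t ⟨extChartAt I x x, hy₀⟩ (hfrep t) (hf2 t ht _)
    (hfc2 t ht _) ((2 * (τ₀ - t))⁻¹)
  rw [hΦ0] at e4
  have e5 : uc t (extChartAt I x x) = u t x := by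
    rw [← hurep t ⟨extChartAt I x x, hy₀⟩, hΦ0]
  rw [conjugateHeatOp_apply, e1, e2, e3, e0 t ht, ← e4, ← e5]
  linarith [key]

end Pointwise

/-! ### Perelman's entropy formula `d𝒲/dt = ∫ 2τ|Ric + Hess f − g/2τ|² u dV` -/

section EntropyFormula

variable {m : ℕ} {H : Type v} [TopologicalSpace H]
  {I : ModelWithCorners ℝ (EuclideanSpace ℝ (Fin m)) H} [I.Boundaryless]
  {M : Type w} [TopologicalSpace M] [ChartedSpace H M] [IsManifold I ∞ M]
  [T2Space M] [CompactSpace M] [MeasurableSpace M] [BorelSpace M]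
  {g : ℝ → PseudoRiemannianMetric I ∞ (EuclideanSpace ℝ (Fin m)) (TangentSpace I : M → Type _)}
  {cov : ℝ → CovariantDerivative I (EuclideanSpace ℝ (Fin m)) (TangentSpace I : M → Type _)}

/-- **`𝒲 = ∫ v dV` along the flow** (Topping 2006, Rem. 8.2.7, in the named vocabulary): for a
Ricci flow of Riemannian metrics on `[0, T']`, `u > 0` smooth on `M × [0, T']`, `τ₀ > T'` and
`s ∈ [0, T']`, `𝒲(g(s), f(s), τ₀ − s) = ∫_M v(s) dV_{g(s)}` with `f = entropyPotential u m τ₀`,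
`v = entropyIntegrand g cov u m τ₀`. [cite: Topping2006, §8.2, Rem. 8.2.7] -/
theorem IsRicciFlow.wEntropy_eq_integral_entropyIntegrand {T' : ℝ} (h : IsRicciFlow g cov (Icc 0 T'))
    (hR : ∀ t ∈ Icc 0 T', (g t).IsRiemannian) {u : ℝ → M → ℝ}
    (hpos : ∀ t ∈ Icc 0 T', ∀ x, 0 < u t x)
    (hu : ContMDiffOn (I.prod 𝓘(ℝ, ℝ)) 𝓘(ℝ, ℝ) ∞ (fun p : M × ℝ ↦ u p.2 p.1) (univ ×ˢ Icc 0 T'))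
    {τ₀ : ℝ} (hτ₀ : T' < τ₀) {s : ℝ} (hs : s ∈ Icc 0 T') :
    (g s).wEntropy (cov s) (entropyPotential u m τ₀ s) (τ₀ - s) =
      ∫ x, entropyIntegrand g cov u m τ₀ s x ∂(g s).riemVolume := by
  have hRc : Continuous fun x ↦ (g s).scalarCurvatureWith (cov s) x :=
    (contMDiff_scalarCurvatureWith_holds I M (g s) (cov s) (h.isLeviCivita s hs)).continuous
  have hτ : 0 < τ₀ - s := by linarith [hs.2]
  have key := wEntropy_eq_integral_conjugateHeatIntegrand (hR s hs) (cov s) hRc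
    (contMDiff_slice_of_contMDiffOn hu hs) (hpos s hs) hτ
  rw [finrank_euclideanSpace_fin] at key
  exact key

/-- **Perelman's entropy formula** (Perelman 2002, (3.4); Topping 2006, Prop. 8.2.1 with
Prop. 8.2.6 and Rem. 8.2.7). Let `(g, cov)` be a Ricci flow of Riemannian metrics on `[0, T']`,
`T' > 0`, on a closed manifold modelled on `ℝ^m`, let `u > 0` solve the conjugate heat equation
`□* u = 0` on `M × [0, T']`, and let `τ₀ > T'`, `τ = τ₀ − t`, `f = −log u − (m/2) log(4πτ)` (so that
`(g, f, τ)` solves Topping's system (8.2.1)). Then at every `t ∈ [0, T']`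

  `d/dt 𝒲(g(t), f(t), τ) = ∫_M 2τ |Ric + Hess f − g/(2τ)|² u dV_{g(t)}`

(derivative within `[0, T']`, one-sided at the end points): `𝒲 = ∫ v dV` (Rem. 8.2.7),
`d/dt ∫ v dV = −∫ □* v dV` ((6.3.2)) and `□* v = −2τ|Ric + Hess f − g/2τ|² u` (Prop. 8.2.6,
`conjugateHeatOp_entropyIntegrand_eq`). In particular `𝒲` is non-decreasing (Topping Cor. of
Prop. 8.2.1; `monotoneOn_wEntropy_of_conjugateHeatOp_entropyIntegrand_nonpos`).
[cite: Perelman2002, §3.1, (3.4)] [cite: Topping2006, §8.2, Prop. 8.2.1] -/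
theorem IsRicciFlow.hasDerivWithinAt_wEntropy {T' : ℝ} (hT' : 0 < T')
    (h : IsRicciFlow g cov (Icc 0 T')) (hR : ∀ t ∈ Icc 0 T', (g t).IsRiemannian)
    {u : ℝ → M → ℝ} (hpos : ∀ t ∈ Icc 0 T', ∀ x, 0 < u t x)
    (hsol : IsConjugateHeatSolutionOn g cov (Icc 0 T') u) {τ₀ : ℝ} (hτ₀ : T' < τ₀) {t : ℝ}
    (ht : t ∈ Icc 0 T') [(g t).HasLeviCivita] :
    HasDerivWithinAt (fun s ↦ (g s).wEntropy (cov s) (entropyPotential u m τ₀ s) (τ₀ - s))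
      (∫ x, 2 * (τ₀ - t) * (g t).normSq x ((g t).ricci x +
        (g t).hessian (entropyPotential u m τ₀ t) x - (2 * (τ₀ - t))⁻¹ • (g t).toBilinForm x) *
        u t x ∂(g t).riemVolume) (Icc 0 T') t := by
  have hu := hsol.1
  have hW : ContMDiffOn (I.prod 𝓘(ℝ, ℝ)) 𝓘(ℝ, ℝ) ∞
      (fun p : M × ℝ ↦ entropyIntegrand g cov u m τ₀ p.2 p.1) (univ ×ˢ Icc 0 T') :=
    h.contMDiffOn_conjugateHeatIntegrand hT' hτ₀ hpos hu m
  -- `d/dt ∫ v dV = ∫ (∂ₜv − Rv) dV`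
  have hD := h.hasDerivWithinAt_integral_of_contMDiffOn (convex_Icc 0 T') hR hW ht
  -- (6.3.2): `= −∫ □* v dV`, and the pointwise identity
  have h632 := h.integral_sub_eq_neg_integral_conjugateHeatOp (convex_Icc 0 T')
    ⟨0, ⟨le_rfl, hT'.le⟩, T', ⟨hT'.le, le_rfl⟩, hT'.ne⟩ hR hW ht
  have hpt : ∀ x, -derivWithin (fun s ↦ entropyIntegrand g cov u m τ₀ s x) (Icc 0 T') t -
      (g t).laplaceBeltrami (entropyIntegrand g cov u m τ₀ t) x +
      (g t).scalarCurvatureWith (cov t) x * entropyIntegrand g cov u m τ₀ t x =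
      -(2 * (τ₀ - t)) * (g t).normSq x ((g t).ricci x +
        (g t).hessian (entropyPotential u m τ₀ t) x - (2 * (τ₀ - t))⁻¹ • (g t).toBilinForm x) *
        u t x := fun x ↦ by
    rw [← conjugateHeatOp_apply]
    exact h.conjugateHeatOp_entropyIntegrand_eq hT' hpos hsol finrank_euclideanSpace_fin hτ₀ ht x
  have hval : ∫ x, (derivWithin (fun s ↦ entropyIntegrand g cov u m τ₀ s x) (Icc 0 T') t -
      (g t).scalarCurvatureWith (cov t) x * entropyIntegrand g cov u m τ₀ t x) ∂(g t).riemVolume =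
      ∫ x, 2 * (τ₀ - t) * (g t).normSq x ((g t).ricci x +
        (g t).hessian (entropyPotential u m τ₀ t) x - (2 * (τ₀ - t))⁻¹ • (g t).toBilinForm x) *
        u t x ∂(g t).riemVolume := by
    rw [h632, ← integral_neg]
    refine integral_congr_ae (Eventually.of_forall fun x ↦ ?_)
    simp only [hpt x]
    ring
  -- `𝒲 = ∫ v dV` on `[0, T']`
  have hWv : ∀ s ∈ Icc 0 T', (g s).wEntropy (cov s) (entropyPotential u m τ₀ s) (τ₀ - s) =
      ∫ x, entropyIntegrand g cov u m τ₀ s x ∂(g s).riemVolume := fun s hs ↦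
    h.wEntropy_eq_integral_entropyIntegrand hR hpos hu hτ₀ hs
  exact ((hD.congr_of_mem hWv ht).congr_deriv hval)

end EntropyFormula

end Literature.Geometry.Riemannian

end
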